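import Mathlib
import HarnessLib
import Summits.HubbardSuperconductivity.HubbardSuperconductivity.Theorems.KLProgrammeKLRegimeSplitFrameExtFnSymmetric

/-!
# Route `KLProgramme`, crux K3 — Δ23 / (R-I): the de-interpolated two-leg PIECES `klTwoLegPieceFn … K n` are the G-extensions of the
# INCREMENT profiles (`ν_{n+1} − ν_n`, `ν_0 − K∘k_F`), so their (E3a-Fn) sizes, `ContDiff` and `IsSymmetricFrame` conjuncts reduce to
# ANGULAR data of the increments — with volume-free numerals

Cell gate-hubbard-kl, seat hubbard-kl-k3c3-p1 (g2; row «δμ-flow with `klAngularMean` constant piece»).  Puts the symbol-side chain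
(`…SplitFrameExtFnBounds`, `…SplitFrameExtFnSymmetric`) in the vocabulary of p2 g6's (R-I) slot texts (`…SplitFrameFn` §3–§4:
`klTwoLegPolyFn = klFrameExtFn μ ∘ klLocalPartFn`, `klFrameProjFn`, `klTwoLegPieceFn`, `TwoLegSizesFn`, `TwoLegSizesMSFn`, `FrameOKFn`):

* §1 `klFrameExtFn_sub_eq` (p2's linearity as an identity of `FrameFn`s), **`klTwoLegPieceFn_succ_eq_klFrameExtFn`**
  (`ℓ_{n+1}(K) = klFrameExtFn μ (ν_{n+1}(K) − ν_n(K))`) and **`klTwoLegPieceFn_zero_eq_klFrameExtFn`** (`ℓ_0(K) = klFrameExtFn μ (ν_0(K) − K∘k_F^K)`),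
  under interval-integrability of the profiles (continuity suffices);
* §2 for any piece `P = klFrameExtFn μ δ`: `norm_iteratedFDeriv_onM_piece_le` (sizes), `contDiff_onM_piece`, `isSymmetricFrame_piece`;
* §3 **`norm_iteratedFDeriv_onM_klTwoLegPieceFn_succ_le`**: with `δ = ν_{n+1}(K) − ν_n(K)` `C^N`, `2π`-periodic, `‖Dⁱ(δ − mean δ)‖ ≤ G`
  (`i ≤ j`), `μ ∈ klWindowC`, at EVERY momentum
  `‖Dʲ onM (klTwoLegPieceFn L M β U μ K (n+1)) q‖ ≤ [j=0]·|mean δ| + (j!)²·(2·j!·X·200ʲ)·G·(4 + max 1 (5(j−1)!/8))ʲ`;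
  **`contDiff_onM_klTwoLegPieceFn_succ`** (the `ContDiff ℝ 4` conjunct of `TwoLegSizesFn` from `δ ∈ C⁴`);
  **`isSymmetricFrame_klTwoLegPieceFn_succ`** (the symmetry conjunct of `FrameOKFn`/`TwoLegSizesMSFn` for the piece from `δ` even, `2π`-periodic,
  `δ(π/2−θ) = δ(θ)` — k3c3-p3's `klLocalPart_neg` / quarter-turn symmetries transported by p2's `klLocalPartFn … K.eval = klLocalPart … K`).

So for the two-leg stubs of 19855 under Δ23: what the ENGINE owes per scale is (i) the continuity/`C⁴`/periodicity/`D₄` of `ν_n(K)` in the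
angle (chain rule through `k_F^K`: p1b `contDiff_klFermiPoint`, k3c3-p3 order-≤4 curve bounds) and (ii) the ANGULAR sizes `G_n,j` of the mean-free
increment — the constant piece `mean δ` enters only at `j = 0` (the δμ-flow), every numeral is volume-free.  Proofs only; nothing is asserted
about the model.
-/

noncomputable section

namespace Summit.HubbardSuperconductivity.HubbardSuperconductivity.Theorems.KLRegimeSplit

set_option linter.dupNamespace false -- summit = problem name (single-conjunct summit), D-0017

open Real Finset Filter MeasureTheory Literature.MathematicalPhysics.QuantumLattice Literature.MathematicalPhysics.QuantumLattice.FermiRG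
open scoped Topology

/-! ## §1 Differences of G-extensions -/

/-- The difference of two G-extensions is the G-extension of the difference of the profiles (p2's `klFrameExtFn_sub`, as `FrameFn`s). -/
theorem klFrameExtFn_sub_eq (μ : ℝ) {f g : ℝ → ℝ} (hf : IntervalIntegrable f volume 0 (2 * π))
    (hg : IntervalIntegrable g volume 0 (2 * π)) :
    klFrameExtFn μ f - klFrameExtFn μ g = klFrameExtFn μ (fun θ => f θ - g θ) := by
  rw [klFrameExtFn_sub μ hf hg]; rfl

section Pieces

variable (L M : ℕ) [NeZero L] [NeZero M]

/-- **The piece at scale `n + 1` is the G-extension of the increment of the local part**: `ℓ_{n+1}(K) = klFrameExtFn μ (ν_{n+1}(K) − ν_n(K))`. -/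
theorem klTwoLegPieceFn_succ_eq_klFrameExtFn (β U μ : ℝ) (K : FrameFn) (n : ℕ)
    (h₁ : IntervalIntegrable (klLocalPartFn L M β U μ K (n + 1)) volume 0 (2 * π))
    (h₀ : IntervalIntegrable (klLocalPartFn L M β U μ K n) volume 0 (2 * π)) :
    klTwoLegPieceFn L M β U μ K (n + 1) =
      klFrameExtFn μ (fun θ => klLocalPartFn L M β U μ K (n + 1) θ - klLocalPartFn L M β U μ K n θ) := by
  rw [klTwoLegPieceFn_succ, klTwoLegPolyFn, klTwoLegPolyFn, klFrameExtFn_sub_eq μ h₁ h₀]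

/-- **The piece at scale `0` is the G-extension of `ν_0(K) − K∘k_F^K`**. -/
theorem klTwoLegPieceFn_zero_eq_klFrameExtFn (β U μ : ℝ) (K : FrameFn)
    (h₀ : IntervalIntegrable (klLocalPartFn L M β U μ K 0) volume 0 (2 * π))
    (hK : IntervalIntegrable (fun θ => K (klFermiPointFn μ K θ)) volume 0 (2 * π)) :
    klTwoLegPieceFn L M β U μ K 0 =
      klFrameExtFn μ (fun θ => klLocalPartFn L M β U μ K 0 θ - K (klFermiPointFn μ K θ)) := by
  rw [klTwoLegPieceFn_zero, klTwoLegPolyFn, klFrameProjFn, klFrameExtFn_sub_eq μ h₀ hK]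

end Pieces

/-! ## §2 Sizes, smoothness and symmetry of a piece from the angular data of its increment profile -/

section PieceBounds

variable {δ : ℝ → ℝ} {N : WithTop ℕ∞}

/-- **(E3a-Fn) for a G-extended increment**: if a piece is `klFrameExtFn μ δ` for an increment profile `δ` (`C^N`, `2π`-periodic) with
`‖Dⁱ(δ − mean δ)‖ ≤ G` (`i ≤ j`), then at every momentum
`‖Dʲ (onM piece) q‖ ≤ [j=0]·|mean δ| + (j!)²·(2·j!·X·200ʲ)·G·(4 + max 1 (5(j−1)!/8))ʲ` (`X ≥ sup_{l≤j}‖Dˡχ₂‖`). -/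
theorem norm_iteratedFDeriv_onM_piece_le {P : FrameFn} {μ : ℝ} (hP : P = klFrameExtFn μ δ) (hδ : ContDiff ℝ N δ)
    (hper : Function.Periodic δ (2 * π)) {j : ℕ} (hj : (j : WithTop ℕ∞) ≤ N) {G X : ℝ} (hμ : μ ∈ klWindowC)
    (hG : ∀ i ≤ j, ∀ t : ℝ, ‖iteratedFDeriv ℝ i (fun t => δ t - klAngularMean δ) t‖ ≤ G)
    (hX : ∀ l ≤ j, ∀ x : ℝ, ‖iteratedFDeriv ℝ l salmhoferCutoff x‖ ≤ X) (q : Momentum) :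
    ‖iteratedFDeriv ℝ j (onM P) q‖ ≤
      (if j = 0 then |klAngularMean δ| else 0) +
        (j.factorial : ℝ) ^ 2 * (2 * j.factorial * X * 200 ^ j) * G * (4 + max 1 (((j - 1).factorial : ℝ) / (8 / 5))) ^ j := by
  rw [hP]
  exact norm_iteratedFDeriv_onM_klFrameExtFn_le hδ hper hj hμ hG hX q

/-- **Smoothness of a G-extended piece.** -/
theorem contDiff_onM_piece {P : FrameFn} {μ : ℝ} (hP : P = klFrameExtFn μ δ) {N' : ℕ∞} (hδ : ContDiff ℝ N' δ)
    (hper : Function.Periodic δ (2 * π)) (hμ : μ ∈ klWindowC) : ContDiff ℝ N' (onM P) := by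
  rw [hP]
  exact contDiff_onM_klFrameExtFn hδ hper hμ

/-- **Symmetry of a G-extended piece.** -/
theorem isSymmetricFrame_piece {P : FrameFn} {μ : ℝ} (hP : P = klFrameExtFn μ δ) (hper : Function.Periodic δ (2 * π))
    (heven : ∀ θ, δ (-θ) = δ θ) (hdiag : ∀ θ, δ (π / 2 - θ) = δ θ) (hμ : -(39 / 10) ≤ μ) : IsSymmetricFrame P := by
  rw [hP]
  exact isSymmetricFrame_klFrameExtFn hper heven hdiag hμ

end PieceBounds

/-! ## §3 The scale-`n+1` piece of the de-interpolated two-leg slot -/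

section Slot

variable {L M : ℕ} [NeZero L] [NeZero M]

/-- **Sizes of `klTwoLegPieceFn … K (n+1)` from the increment of the local part**: with `δ = ν_{n+1}(K) − ν_n(K)` `C^N` and `2π`-periodic,
`‖Dⁱ(δ − mean δ)‖ ≤ G` (`i ≤ j`), `μ ∈ klWindowC`:
`‖Dʲ onM (klTwoLegPieceFn L M β U μ K (n+1)) q‖ ≤ [j=0]·|mean δ| + (j!)²·(2·j!·X·200ʲ)·G·(4 + max 1 (5(j−1)!/8))ʲ` at every `q` — the
(E3a-Fn) tier-1/tier-2 sizes reduce to the ANGULAR sizes of the increment (the engine's (E3g)-type output) with volume-free numerals. -/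
theorem norm_iteratedFDeriv_onM_klTwoLegPieceFn_succ_le {β U μ : ℝ} {K : FrameFn} {n : ℕ} {N : WithTop ℕ∞}
    (hc₁ : Continuous (klLocalPartFn L M β U μ K (n + 1))) (hc₀ : Continuous (klLocalPartFn L M β U μ K n))
    (hδ : ContDiff ℝ N (fun θ => klLocalPartFn L M β U μ K (n + 1) θ - klLocalPartFn L M β U μ K n θ))
    (hper : Function.Periodic (fun θ => klLocalPartFn L M β U μ K (n + 1) θ - klLocalPartFn L M β U μ K n θ) (2 * π))
    {j : ℕ} (hj : (j : WithTop ℕ∞) ≤ N) {G X : ℝ} (hμ : μ ∈ klWindowC)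
    (hG : ∀ i ≤ j, ∀ t : ℝ, ‖iteratedFDeriv ℝ i (fun t =>
      (klLocalPartFn L M β U μ K (n + 1) t - klLocalPartFn L M β U μ K n t) -
        klAngularMean (fun θ => klLocalPartFn L M β U μ K (n + 1) θ - klLocalPartFn L M β U μ K n θ)) t‖ ≤ G)
    (hX : ∀ l ≤ j, ∀ x : ℝ, ‖iteratedFDeriv ℝ l salmhoferCutoff x‖ ≤ X) (q : Momentum) :
    ‖iteratedFDeriv ℝ j (onM (klTwoLegPieceFn L M β U μ K (n + 1))) q‖ ≤
      (if j = 0 then |klAngularMean (fun θ => klLocalPartFn L M β U μ K (n + 1) θ - klLocalPartFn L M β U μ K n θ)| else 0) +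
        (j.factorial : ℝ) ^ 2 * (2 * j.factorial * X * 200 ^ j) * G * (4 + max 1 (((j - 1).factorial : ℝ) / (8 / 5))) ^ j :=
  norm_iteratedFDeriv_onM_piece_le
    (klTwoLegPieceFn_succ_eq_klFrameExtFn L M β U μ K n (hc₁.intervalIntegrable _ _) (hc₀.intervalIntegrable _ _)) hδ hper hj hμ
    hG hX q

/-- **Smoothness of `klTwoLegPieceFn … K (n+1)`** from the smoothness of the increment of the local part. -/
theorem contDiff_onM_klTwoLegPieceFn_succ {β U μ : ℝ} {K : FrameFn} {n : ℕ} {N' : ℕ∞}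
    (hc₁ : Continuous (klLocalPartFn L M β U μ K (n + 1))) (hc₀ : Continuous (klLocalPartFn L M β U μ K n))
    (hδ : ContDiff ℝ N' (fun θ => klLocalPartFn L M β U μ K (n + 1) θ - klLocalPartFn L M β U μ K n θ))
    (hper : Function.Periodic (fun θ => klLocalPartFn L M β U μ K (n + 1) θ - klLocalPartFn L M β U μ K n θ) (2 * π))
    (hμ : μ ∈ klWindowC) : ContDiff ℝ N' (onM (klTwoLegPieceFn L M β U μ K (n + 1))) :=
  contDiff_onM_piece
    (klTwoLegPieceFn_succ_eq_klFrameExtFn L M β U μ K n (hc₁.intervalIntegrable _ _) (hc₀.intervalIntegrable _ _)) hδ hper hμ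

/-- **Symmetry of `klTwoLegPieceFn … K (n+1)`** from the `D₄`-symmetries of the increment of the local part. -/
theorem isSymmetricFrame_klTwoLegPieceFn_succ {β U μ : ℝ} {K : FrameFn} {n : ℕ}
    (hc₁ : Continuous (klLocalPartFn L M β U μ K (n + 1))) (hc₀ : Continuous (klLocalPartFn L M β U μ K n))
    (hper : Function.Periodic (fun θ => klLocalPartFn L M β U μ K (n + 1) θ - klLocalPartFn L M β U μ K n θ) (2 * π))
    (heven : ∀ θ, klLocalPartFn L M β U μ K (n + 1) (-θ) - klLocalPartFn L M β U μ K n (-θ) =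
      klLocalPartFn L M β U μ K (n + 1) θ - klLocalPartFn L M β U μ K n θ)
    (hdiag : ∀ θ, klLocalPartFn L M β U μ K (n + 1) (π / 2 - θ) - klLocalPartFn L M β U μ K n (π / 2 - θ) =
      klLocalPartFn L M β U μ K (n + 1) θ - klLocalPartFn L M β U μ K n θ)
    (hμ : μ ∈ klWindowC) : IsSymmetricFrame (klTwoLegPieceFn L M β U μ K (n + 1)) := by
  have hμ' := hμ
  simp only [klWindowC, Set.mem_Icc] at hμ'
  exact isSymmetricFrame_piece
    (klTwoLegPieceFn_succ_eq_klFrameExtFn L M β U μ K n (hc₁.intervalIntegrable _ _) (hc₀.intervalIntegrable _ _)) hper heven hdiag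
    (by linarith)

end Slot

end Summit.HubbardSuperconductivity.HubbardSuperconductivity.Theorems.KLRegimeSplit

end
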